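import Summits.CriticalPhenomena.CardyFormulaZ2.Theses.CardyComplexCone

/-!
# Assembly of route `CardyComplexCone` (sub-problem `CardyFormulaZ2`)

Item `stmt-CriticalPhenomena-11267`: the assembly statement
`EdgeCoherence → EdgePrecompact → CoherentMorera → ParafermionToSLESixFamilies →
SLESixFamiliesGiveCardy → CardyFormulaZ2` of the route
`route-CriticalPhenomena-CardyComplexCone`.  It is pure modus ponens: `CoherentMorera`
turns the two edge hypotheses into the pair of inputs of `ParafermionToSLESixFamilies`,
whose conclusion is verbatim the antecedent of `SLESixFamiliesGiveCardy`; this is exactly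
the body of the route's deciding theorem `closes`.
-/

namespace Summit.CriticalPhenomena.CardyFormulaZ2.Theorems

open Summit.CriticalPhenomena.CardyFormulaZ2.Theses

/-- **Assembly of the `CardyComplexCone` route** (item `stmt-CriticalPhenomena-11267`):
the five route hypotheses `EdgeCoherence`, `EdgePrecompact`, `CoherentMorera`,
`ParafermionToSLESixFamilies`, `SLESixFamiliesGiveCardy` imply `CardyFormulaZ2`, by modus ponens
(the same term as the route's deciding theorem `CardyComplexCone.closes`). -/
theorem cardyComplexCone_assembly_proof : CardyComplexCone.Assembly := by
  unfold CardyComplexCone.Assembly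
  intro hC hP hM hS hG
  exact hG (hS (hM hC hP).1 (hM hC hP).2)

end Summit.CriticalPhenomena.CardyFormulaZ2.Theorems
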